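import Literature.Probability.Percolation.KozmaNitzanPreFKG
import HarnessLib

/-!
# The partition datum of four relay points seen from an outside observer

builds on p205010 (kernel theorem, internal audit signed; external expert review pending)

PAPER-2 track "percolation constants", part (ii), seat `prim-consts-1` (lane index `run/shared/lean/prim/consts/CONSTANTS.md`,
row A19, §4 N18/N23).  Support file for the crux `NoHeavyLowerTail` (stmt-CriticalPhenomena-4575; `--supports`): infrastructure
for `…ConstsLinearLowerTailFourFreeCore` (the certificate) and `…ConstsLinearLowerTailFourFree` ((LT³⁄₂) for `o ∉ A`, `|A| = 4`).

An observer `o` and four marked relay points `x 0, …, x 3` of a finite weighted graph determine, for every bond configuration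
`ω`, a set partition of the five points (the traces of the open clusters).  We encode it by a **datum** `d : Fin 5 × Fin 5 × Fin 5
× Fin 5`: the label of `x k` is `0` if `x k ↔ o`, and otherwise `m + 1` where `m` is the least index with `x m ↔ x k`.  The 52
possible data (`GOODL`, one per set partition of five points) index a **fibre decomposition** of every event determined by the
connectivity pattern (`real_setOf_datum`); connectivity is read off the datum (`conn_iff`, `obs_iff`).  Finally `pa_one` is the
event form of van den Berg–Häggström–Kahn's conditional positive association of the cluster of a relay point `p` given
`{p ↮ q}` (Thm. 1.3; kernel theorem `BHK2006_clusterConditionalPositiveAssociation_holds` via `KNPreFKG.bhk_one_upper_upper`)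
for the two increasing events "`a ∈ C(p)`", "`b ∈ C(p)`" — the only input beyond pair budgets used by the certificate.

References: J. van den Berg, O. Häggström, J. Kahn, Random Structures Algorithms 29 (2006) 417–435, Thm. 1.3 (p. 6);
G. Grimmett, *Percolation* (1999), §2.2.
-/

noncomputable section

namespace Summit.CriticalPhenomena.PercolationContinuityZ3.Theorems

open MeasureTheory Set Literature.Probability.LatticeModels Literature.Probability.Percolation

namespace Consts

namespace FourFree

/-- The datum type: one label in `Fin 5` for each of the four relay points (`0` = joined to the observer; `m + 1` = not joined
to the observer, and `m` is the least index of a relay point in the same open cluster). [folklore] -/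
abbrev D4 : Type := Fin 5 × Fin 5 × Fin 5 × Fin 5

/-- Component `k` of a datum. [folklore] -/
def D4.get (d : D4) : Fin 4 → Fin 5
  | ⟨0, _⟩ => d.1
  | ⟨1, _⟩ => d.2.1
  | ⟨2, _⟩ => d.2.2.1
  | ⟨_ + 3, _⟩ => d.2.2.2

/-- Component `0` of a datum. [folklore] -/
@[simp] theorem D4.get_zero (d : D4) : d.get 0 = d.1 := rfl

/-- Component `1` of a datum. [folklore] -/
@[simp] theorem D4.get_one (d : D4) : d.get 1 = d.2.1 := rfl

/-- Component `2` of a datum. [folklore] -/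
@[simp] theorem D4.get_two (d : D4) : d.get 2 = d.2.2.1 := rfl

/-- Component `3` of a datum. [folklore] -/
@[simp] theorem D4.get_three (d : D4) : d.get 3 = d.2.2.2 := rfl

/-- The 52 valid data, one per set partition of the five points `o, x 0, x 1, x 2, x 3`. [folklore] -/
def GOODL : List D4 :=
  [(0, 0, 0, 0), (0, 0, 0, 4), (0, 0, 3, 0), (0, 0, 3, 3), (0, 0, 3, 4), (0, 2, 0, 0), (0, 2, 0, 2), (0, 2, 0, 4),
    (0, 2, 2, 0), (0, 2, 2, 2), (0, 2, 2, 4), (0, 2, 3, 0), (0, 2, 3, 2), (0, 2, 3, 3), (0, 2, 3, 4), (1, 0, 0, 0),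
    (1, 0, 0, 1), (1, 0, 0, 4), (1, 0, 1, 0), (1, 0, 1, 1), (1, 0, 1, 4), (1, 0, 3, 0), (1, 0, 3, 1), (1, 0, 3, 3),
    (1, 0, 3, 4), (1, 1, 0, 0), (1, 1, 0, 1), (1, 1, 0, 4), (1, 1, 1, 0), (1, 1, 1, 1), (1, 1, 1, 4), (1, 1, 3, 0),
    (1, 1, 3, 1), (1, 1, 3, 3), (1, 1, 3, 4), (1, 2, 0, 0), (1, 2, 0, 1), (1, 2, 0, 2), (1, 2, 0, 4), (1, 2, 1, 0),
    (1, 2, 1, 1), (1, 2, 1, 2), (1, 2, 1, 4), (1, 2, 2, 0), (1, 2, 2, 1), (1, 2, 2, 2), (1, 2, 2, 4), (1, 2, 3, 0),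
    (1, 2, 3, 1), (1, 2, 3, 2), (1, 2, 3, 3), (1, 2, 3, 4)]

/-- The 52 valid data as a `Finset`. [folklore] -/
def GOOD : Finset D4 := GOODL.toFinset

/-- The list of valid data has no duplicates. [folklore] -/
theorem GOODL_nodup : GOODL.Nodup := by decide

/-- A sum over the valid data is the explicit 52-term sum. [folklore] -/
theorem sum_GOOD (g : D4 → ℝ) : ∑ d ∈ GOOD, g d = (GOODL.map g).sum := by
  rw [GOOD, List.sum_toFinset _ GOODL_nodup]

/-- Every datum satisfying the validity condition (each nonzero label `m + 1` points to an index `m ≤ k` with the same label)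
is one of the 52 listed data (checked by `decide` over all `625` label vectors). [folklore] -/
theorem mem_GOODL_of_valid : ∀ d : D4,
    (∀ k : Fin 4, d.get k = 0 ∨ ∃ m : Fin 4, (d.get k).val = m.val + 1 ∧ m.val ≤ k.val ∧ d.get m = d.get k) → d ∈ GOODL := by
  set_option maxRecDepth 100000 in decide

open scoped Classical

variable {n : ℕ}

/-- The indices of the relay points joined to `x k`. [folklore] -/
def blk (x : Fin 4 → Fin n) (ω : BondConfig (Fin n)) (k : Fin 4) : Finset (Fin 4) :=
  Finset.univ.filter fun l => ω ∈ openConn (x k) (x l)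

/-- `k` is in its own block. [folklore] -/
theorem mem_blk_self (x : Fin 4 → Fin n) (ω : BondConfig (Fin n)) (k : Fin 4) : k ∈ blk x ω k := by
  simp [blk, openConn]

/-- The least index in the open cluster of `x k` among the four relay points. [folklore] -/
def rep (x : Fin 4 → Fin n) (ω : BondConfig (Fin n)) (k : Fin 4) : Fin 4 :=
  (blk x ω k).min' ⟨k, mem_blk_self x ω k⟩

/-- The representative is joined to `x k`. [folklore] -/
theorem rep_mem (x : Fin 4 → Fin n) (ω : BondConfig (Fin n)) (k : Fin 4) :
    ω ∈ openConn (x k) (x (rep x ω k)) :=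
  (Finset.mem_filter.1 (Finset.min'_mem (blk x ω k) ⟨k, mem_blk_self x ω k⟩)).2

/-- The representative is at most `k`. [folklore] -/
theorem rep_le (x : Fin 4 → Fin n) (ω : BondConfig (Fin n)) (k : Fin 4) : rep x ω k ≤ k :=
  Finset.min'_le (blk x ω k) k (mem_blk_self x ω k)

/-- Joined relay points have comparable representatives. [folklore] -/
theorem rep_le_of_conn (x : Fin 4 → Fin n) (ω : BondConfig (Fin n)) {k l : Fin 4}
    (h : ω ∈ openConn (x k) (x l)) : rep x ω l ≤ rep x ω k := by
  apply Finset.min'_le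
  simp only [blk, Finset.mem_filter, Finset.mem_univ, true_and]
  have h1 : (openGraph ω).Reachable (x k) (x l) := h
  have h2 : (openGraph ω).Reachable (x k) (x (rep x ω k)) := rep_mem x ω k
  exact h1.symm.trans h2

/-- Joined relay points have the same representative. [folklore] -/
theorem rep_eq_of_conn (x : Fin 4 → Fin n) (ω : BondConfig (Fin n)) {k l : Fin 4}
    (h : ω ∈ openConn (x k) (x l)) : rep x ω k = rep x ω l :=
  le_antisymm (rep_le_of_conn x ω (show (openGraph ω).Reachable (x l) (x k) from
    (show (openGraph ω).Reachable (x k) (x l) from h).symm)) (rep_le_of_conn x ω h)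

/-- Relay points with the same representative are joined. [folklore] -/
theorem conn_of_rep_eq (x : Fin 4 → Fin n) (ω : BondConfig (Fin n)) {k l : Fin 4}
    (h : rep x ω k = rep x ω l) : ω ∈ openConn (x k) (x l) := by
  have h1 : (openGraph ω).Reachable (x k) (x (rep x ω k)) := rep_mem x ω k
  have h2 : (openGraph ω).Reachable (x l) (x (rep x ω l)) := rep_mem x ω l
  rw [h] at h1
  exact h1.trans h2.symm

/-- The label of relay point `k`: `0` if joined to the observer, else `rep + 1`. [folklore] -/
def lab (o : Fin n) (x : Fin 4 → Fin n) (ω : BondConfig (Fin n)) (k : Fin 4) : Fin 5 :=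
  if ω ∈ openConn o (x k) then 0 else (rep x ω k).succ

/-- Label `0` means joined to the observer. [folklore] -/
theorem lab_eq_zero_iff (o : Fin n) (x : Fin 4 → Fin n) (ω : BondConfig (Fin n)) (k : Fin 4) :
    lab o x ω k = 0 ↔ ω ∈ openConn o (x k) := by
  unfold lab
  split_ifs with h
  · simp [h]
  · simp [h, Fin.succ_ne_zero]

/-- Equal labels means joined. [folklore] -/
theorem lab_eq_lab_iff (o : Fin n) (x : Fin 4 → Fin n) (ω : BondConfig (Fin n)) (k l : Fin 4) :
    lab o x ω k = lab o x ω l ↔ ω ∈ openConn (x k) (x l) := by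
  by_cases hk : ω ∈ openConn o (x k)
  · have hk' : (openGraph ω).Reachable o (x k) := hk
    rw [(lab_eq_zero_iff o x ω k).2 hk, eq_comm, lab_eq_zero_iff]
    change (openGraph ω).Reachable o (x l) ↔ (openGraph ω).Reachable (x k) (x l)
    exact ⟨fun hl => hk'.symm.trans hl, fun hkl => hk'.trans hkl⟩
  · by_cases hl : ω ∈ openConn o (x l)
    · have hl' : (openGraph ω).Reachable o (x l) := hl
      rw [(lab_eq_zero_iff o x ω l).2 hl]
      constructor
      · intro h0; exact absurd ((lab_eq_zero_iff o x ω k).1 h0) hk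
      · intro hkl
        exact absurd (show ω ∈ openConn o (x k) from
          (hl'.trans (show (openGraph ω).Reachable (x k) (x l) from hkl).symm)) hk
    · simp only [lab, hk, hl, if_false, Fin.succ_inj]
      exact ⟨conn_of_rep_eq x ω, rep_eq_of_conn x ω⟩

/-- The datum of a configuration. [folklore] -/
def datum (o : Fin n) (x : Fin 4 → Fin n) (ω : BondConfig (Fin n)) : D4 :=
  (lab o x ω 0, lab o x ω 1, lab o x ω 2, lab o x ω 3)

/-- Components of the datum are the labels. [folklore] -/
theorem datum_get (o : Fin n) (x : Fin 4 → Fin n) (ω : BondConfig (Fin n)) (k : Fin 4) :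
    (datum o x ω).get k = lab o x ω k := by
  fin_cases k <;> rfl

/-- Every datum is one of the 52 valid data. [folklore] -/
theorem datum_mem_GOOD (o : Fin n) (x : Fin 4 → Fin n) (ω : BondConfig (Fin n)) : datum o x ω ∈ GOOD := by
  rw [GOOD, List.mem_toFinset]
  refine mem_GOODL_of_valid _ fun k => ?_
  rw [datum_get]
  by_cases hk : ω ∈ openConn o (x k)
  · exact Or.inl ((lab_eq_zero_iff o x ω k).2 hk)
  · refine Or.inr ⟨rep x ω k, by simp [lab, hk], rep_le x ω k, ?_⟩
    rw [datum_get, lab_eq_lab_iff]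
    exact (show (openGraph ω).Reachable (x k) (x (rep x ω k)) from rep_mem x ω k).symm

/-- **Fibre decomposition**: the probability of an event determined by the datum is the sum, over the valid data satisfying
it, of the fibre masses `μ(datum = d)`. [folklore] -/
theorem real_setOf_datum (w : Sym2 (Fin n) → unitInterval) (o : Fin n) (x : Fin 4 → Fin n)
    (P : D4 → Prop) [DecidablePred P] :
    (prodBernoulli w).real {ω | P (datum o x ω)} =
      ∑ d ∈ GOOD, if P d then (prodBernoulli w).real {ω | datum o x ω = d} else 0 := by
  have hset : {ω : BondConfig (Fin n) | P (datum o x ω)} = (datum o x) ⁻¹' ↑(GOOD.filter P) := by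
    ext ω
    simp only [mem_setOf_eq, mem_preimage, Finset.coe_filter]
    exact ⟨fun h => ⟨datum_mem_GOOD o x ω, h⟩, fun h => h.2⟩
  rw [hset, ← sum_measureReal_preimage_singleton (GOOD.filter P) (fun _ _ => MeasurableSet.of_discrete),
    Finset.sum_filter]
  rfl

/-- Relay points `k` and `l` are joined iff their labels agree. [folklore] -/
theorem conn_iff (o : Fin n) (x : Fin 4 → Fin n) (ω : BondConfig (Fin n)) (k l : Fin 4) :
    ω ∈ openConn (x k) (x l) ↔ (datum o x ω).get k = (datum o x ω).get l := by
  rw [datum_get, datum_get, lab_eq_lab_iff]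

/-- The observer is joined to `x k` iff the label of `k` is `0`. [folklore] -/
theorem obs_iff (o : Fin n) (x : Fin 4 → Fin n) (ω : BondConfig (Fin n)) (k : Fin 4) :
    ω ∈ openConn o (x k) ↔ (datum o x ω).get k = 0 := by
  rw [datum_get, lab_eq_zero_iff]

/-- **Relay-side positive association for two single targets** (vdBHK Thm. 1.3 given `{p ↮ q}`, for the increasing cluster
events "`a ∈ C(p)`" and "`b ∈ C(p)`"): `μ(p↮q, p↔a)·μ(p↮q, p↔b) ≤ μ(p↮q)·μ(p↮q, p↔a, p↔b)`.
[cite: VandenbergHaggstromKahn2005, Thm. 1.3 (p. 6)] -/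
theorem pa_one (w : Sym2 (Fin n) → unitInterval) (p q a b : Fin n) (hq : p ≠ q) :
    (prodBernoulli w).real ((openConn p q)ᶜ ∩ openConn p a) * (prodBernoulli w).real ((openConn p q)ᶜ ∩ openConn p b) ≤
      (prodBernoulli w).real (openConn p q)ᶜ *
        (prodBernoulli w).real ((openConn p q)ᶜ ∩ (openConn p a ∩ openConn p b)) := by
  have hpX : p ∉ ({q} : Set (Fin n)) := by simpa using hq
  have h := KNPreFKG.bhk_one_upper_upper w p ({q} : Set (Fin n)) hpX (KNPreFKG.isUpperSet_connFamily p a)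
    (KNPreFKG.isUpperSet_connFamily p b)
  have hD : {ω : BondConfig (Fin n) | ∀ y ∈ ({q} : Set (Fin n)), ¬ (openGraph ω).Reachable p y} = (openConn p q)ᶜ := by
    ext ω; simp [openConn]
  rw [hD, ← KNPreFKG.openConn_eq_setOf_connFamily, ← KNPreFKG.openConn_eq_setOf_connFamily] at h
  exact h

end FourFree

end Consts

end Summit.CriticalPhenomena.PercolationContinuityZ3.Theorems
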